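import Summits.Ventures.PercRepro.RankLevelSetRuleQPairingCert

/-!
# PercRepro — THE ROW STEP OF THE WHOLE-DIAGONAL PAIRING, UNIFORMLY IN `k` (p4, gen 23; C-044; paper
proofs/P4-CELL-THREE.md §12)

THE ROW STEP OF THE WHOLE-DIAGONAL PAIRING HOLDS FOR EVERY `k ≥ 3` (`rowstep_full`): with `n = u + k`, `q = u + m`,
`P(J) = Σ_{0<i<k} C(n, i)·C(m, J+k−1−i)` (the whole diagonal `J + k − 1` of `rhat_sub_phiK_eq`), every `1 ≤ J ≤ m − 1`
and every `u ≥ k − 1`, `P(J)·(m−J)·(q+J+k) ≤ P(J+1)·(q+J+1)·(J+k)`.  Hence the pairing `C(m,J)·C(q+J+k−1, J+k−1) ≤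
P(J)·C(q+J, J)` propagates from the row `J = 1` to every row (`pairing_of_rowstep`), and with
RankLevelSetRuleQPairingCert: **`rhat_ge_phiK_of_full (q k m) (3 ≤ k) (k − 1 ≤ q − m) (m ≤ q) (h1) : phiK (q+k) q ≤ rhat q k m`**,
where `h1 : m·C(q+k, k) ≤ P(1)·(q+1)` is the single row `J = 1` — the uniform-in-`k` form of the theorems
`rhat_five_of_full` … `rhat_eight_of_full` (their hypotheses are `h1` written out in products), regime `#P ≲ (k−1)q/k`.

PROOF OF THE ROW STEP (four exact steps). (1) `(m+1)·[P(J+1)(q+J+1)(J+k) − P(J)(m−J)(q+J+k)] = Σ_{0<i<k} a_i·L_i` with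
`a_i = C(n,i)·C(m+1, J+k−i)` and `L_i = (m−J)q(k−1) − (k−1−i)·Γ`, `Γ = (m−J)(q+J+k) + (q+J+1)(J+k)` (two binomial
ratios per term, `rowstep_term`); (2) TELESCOPING: `Σ_i a_i·[(k−1)(m−J) − (u+1)(J+1) − (k−1−i)(q+k+1)] =
n(m+1)·[C(m, J+k−1) − C(n−1, k−1)·C(m, J)]` (per term `n(m+1)·(Z(i−1) − Z(i))`, `Z(i) = C(n−1, i)·C(m, J+k−1−i)`;
`telescope_Z`); (3) `(q+k+1)·L_i = Γ·[…] + μ` with `μ = (q+k+1)(m−J)q(k−1) − Γ·((k−1)(m−J) − (u+1)(J+1))` — with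
`k = d + 3`, `u = k − 1 + a`, `J = 1 + b`, `m = J + 1 + c` the polynomial `μ` has 51 non-negative coefficients
(`uniform_mu_nonneg`); (4) keeping only the two top terms `i = k−1, k−2` of `Σ a_i` and dropping `C(m, J+k−1) ≥ 0`, the
remaining inequality `Γ(u+1)(u+2)(J+1)(J+2) ≤ μ·[(u+2)(J+2) + (k−1)(m−J)]` is a polynomial with 120 non-negative
coefficients (`uniform_two_term`).  No defs; axioms standard.
-/

namespace PercRepro

open Finset

/-! ### The two polynomial certificates, uniform in `k` -/

set_option maxHeartbeats 800000 in
/-- **Certificate I**: `μ ≥ 0` (`k = d + 3`, `u = k − 1 + a`, `J = 1 + b`, `m = J + 1 + c`; 51 non-negative coefficients). -/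
lemma uniform_mu_nonneg (a b c d : ℚ) (ha : 0 ≤ a) (hb : 0 ≤ b) (hc : 0 ≤ c) (hd : 0 ≤ d) :
    0 ≤ (((d + 2 + a) + (b + 2 + c) + (d + 3) + 1) * ((b + 2 + c) - (b + 1)) * ((d + 2 + a) + (b + 2 + c)) * ((d + 3) - 1) - (((b + 2 + c) - (b + 1)) * ((d + 2 + a) + (b + 2 + c) + (b + 1) + (d + 3)) + ((d + 2 + a) + (b + 2 + c) + (b + 1) + 1) * ((b + 1) + (d + 3))) * (((d + 3) - 1) * ((b + 2 + c) - (b + 1)) - ((d + 2 + a) + 1) * ((b + 1) + 1))) := by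
  have key : (((d + 2 + a) + (b + 2 + c) + (d + 3) + 1) * ((b + 2 + c) - (b + 1)) * ((d + 2 + a) + (b + 2 + c)) * ((d + 3) - 1) - (((b + 2 + c) - (b + 1)) * ((d + 2 + a) + (b + 2 + c) + (b + 1) + (d + 3)) + ((d + 2 + a) + (b + 2 + c) + (b + 1) + 1) * ((b + 1) + (d + 3))) * (((d + 3) - 1) * ((b + 2 + c) - (b + 1)) - ((d + 2 + a) + 1) * ((b + 1) + 1)))
      = 192 + 144 * d + 36 * d ^ 2 + 3 * d ^ 3 + 76 * c + 51 * c * d + 12 * c * d ^ 2 + 1 * c * d ^ 3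
        + 4 * c ^ 2 + 1 * c ^ 2 * d + 184 * b + 114 * b * d + 21 * b * d ^ 2 + 1 * b * d ^ 3 + 47 * b * c
        + 23 * b * c * d + 3 * b * c * d ^ 2 + 1 * b * c ^ 2 + 58 * b ^ 2 + 28 * b ^ 2 * d + 3 * b ^ 2 * d ^ 2
        + 7 * b ^ 2 * c + 2 * b ^ 2 * c * d + 6 * b ^ 3 + 2 * b ^ 3 * d + 108 * a + 51 * a * d + 6 * a * d ^ 2
        + 48 * a * c + 20 * a * c * d + 2 * a * c * d ^ 2 + 4 * a * c ^ 2 + 1 * a * c ^ 2 * d + 87 * a * b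
        + 29 * a * b * d + 2 * a * b * d ^ 2 + 24 * a * b * c + 5 * a * b * c * d + 1 * a * b * c ^ 2
        + 23 * a * b ^ 2 + 4 * a * b ^ 2 * d + 3 * a * b ^ 2 * c + 2 * a * b ^ 3 + 12 * a ^ 2 + 3 * a ^ 2 * d
        + 4 * a ^ 2 * c + 1 * a ^ 2 * c * d + 7 * a ^ 2 * b + 1 * a ^ 2 * b * d + 1 * a ^ 2 * b * c
        + 1 * a ^ 2 * b ^ 2 := by
    ring
  rw [key]
  positivity

set_option maxHeartbeats 800000 in
/-- **Certificate II**: the two-term inequality (120 non-negative coefficients). -/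
lemma uniform_two_term (a b c d : ℚ) (ha : 0 ≤ a) (hb : 0 ≤ b) (hc : 0 ≤ c) (hd : 0 ≤ d) :
    (((b + 2 + c) - (b + 1)) * ((d + 2 + a) + (b + 2 + c) + (b + 1) + (d + 3)) + ((d + 2 + a) + (b + 2 + c) + (b + 1) + 1) * ((b + 1) + (d + 3))) * ((d + 2 + a) + 1) * ((d + 2 + a) + 2) * ((b + 1) + 1) * ((b + 1) + 2)
      ≤ (((d + 2 + a) + (b + 2 + c) + (d + 3) + 1) * ((b + 2 + c) - (b + 1)) * ((d + 2 + a) + (b + 2 + c)) * ((d + 3) - 1) - (((b + 2 + c) - (b + 1)) * ((d + 2 + a) + (b + 2 + c) + (b + 1) + (d + 3)) + ((d + 2 + a) + (b + 2 + c) + (b + 1) + 1) * ((b + 1) + (d + 3))) * (((d + 3) - 1) * ((b + 2 + c) - (b + 1)) - ((d + 2 + a) + 1) * ((b + 1) + 1))) * (((d + 2 + a) + 2) * ((b + 1) + 2) + ((d + 3) - 1) * ((b + 2 + c) - (b + 1))) := by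
  rw [← sub_nonneg]
  have key : (((d + 2 + a) + (b + 2 + c) + (d + 3) + 1) * ((b + 2 + c) - (b + 1)) * ((d + 2 + a) + (b + 2 + c)) * ((d + 3) - 1) - (((b + 2 + c) - (b + 1)) * ((d + 2 + a) + (b + 2 + c) + (b + 1) + (d + 3)) + ((d + 2 + a) + (b + 2 + c) + (b + 1) + 1) * ((b + 1) + (d + 3))) * (((d + 3) - 1) * ((b + 2 + c) - (b + 1)) - ((d + 2 + a) + 1) * ((b + 1) + 1))) * (((d + 2 + a) + 2) * ((b + 1) + 2) + ((d + 3) - 1) * ((b + 2 + c) - (b + 1)))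
      - (((b + 2 + c) - (b + 1)) * ((d + 2 + a) + (b + 2 + c) + (b + 1) + (d + 3)) + ((d + 2 + a) + (b + 2 + c) + (b + 1) + 1) * ((b + 1) + (d + 3))) * ((d + 2 + a) + 1) * ((d + 2 + a) + 2) * ((b + 1) + 1) * ((b + 1) + 2)
      = 384 + 576 * d + 312 * d ^ 2 + 72 * d ^ 3 + 6 * d ^ 4 + 512 * c + 736 * c * d + 384 * c * d ^ 2
        + 86 * c * d ^ 3 + 7 * c * d ^ 4 + 136 * c ^ 2 + 166 * c ^ 2 * d + 73 * c ^ 2 * d ^ 2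
        + 14 * c ^ 2 * d ^ 3 + 1 * c ^ 2 * d ^ 4 + 8 * c ^ 3 + 6 * c ^ 3 * d + 1 * c ^ 3 * d ^ 2 + 272 * b
        + 372 * b * d + 176 * b * d ^ 2 + 33 * b * d ^ 3 + 2 * b * d ^ 4 + 334 * b * c + 441 * b * c * d
        + 201 * b * c * d ^ 2 + 36 * b * c * d ^ 3 + 2 * b * c * d ^ 4 + 64 * b * c ^ 2 + 70 * b * c ^ 2 * d
        + 25 * b * c ^ 2 * d ^ 2 + 3 * b * c ^ 2 * d ^ 3 + 2 * b * c ^ 3 + 1 * b * c ^ 3 * d + 60 * b ^ 2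
        + 72 * b ^ 2 * d + 27 * b ^ 2 * d ^ 2 + 3 * b ^ 2 * d ^ 3 + 66 * b ^ 2 * c + 77 * b ^ 2 * c * d
        + 28 * b ^ 2 * c * d ^ 2 + 3 * b ^ 2 * c * d ^ 3 + 6 * b ^ 2 * c ^ 2 + 5 * b ^ 2 * c ^ 2 * d
        + 1 * b ^ 2 * c ^ 2 * d ^ 2 + 4 * b ^ 3 + 4 * b ^ 3 * d + 1 * b ^ 3 * d ^ 2 + 4 * b ^ 3 * c
        + 4 * b ^ 3 * c * d + 1 * b ^ 3 * c * d ^ 2 + 384 * a + 408 * a * d + 138 * a * d ^ 2 + 15 * a * d ^ 3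
        + 498 * a * c + 511 * a * c * d + 165 * a * c * d ^ 2 + 17 * a * c * d ^ 3 + 122 * a * c ^ 2
        + 109 * a * c ^ 2 * d + 28 * a * c ^ 2 * d ^ 2 + 2 * a * c ^ 2 * d ^ 3 + 8 * a * c ^ 3
        + 6 * a * c ^ 3 * d + 1 * a * c ^ 3 * d ^ 2 + 230 * a * b + 217 * a * b * d + 61 * a * b * d ^ 2
        + 5 * a * b * d ^ 3 + 278 * a * b * c + 253 * a * b * c * d + 67 * a * b * c * d ^ 2
        + 5 * a * b * c * d ^ 3 + 50 * a * b * c ^ 2 + 37 * a * b * c ^ 2 * d + 6 * a * b * c ^ 2 * d ^ 2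
        + 2 * a * b * c ^ 3 + 1 * a * b * c ^ 3 * d + 40 * a * b ^ 2 + 30 * a * b ^ 2 * d
        + 5 * a * b ^ 2 * d ^ 2 + 44 * a * b ^ 2 * c + 32 * a * b ^ 2 * c * d + 5 * a * b ^ 2 * c * d ^ 2
        + 4 * a * b ^ 2 * c ^ 2 + 2 * a * b ^ 2 * c ^ 2 * d + 2 * a * b ^ 3 + 1 * a * b ^ 3 * d
        + 2 * a * b ^ 3 * c + 1 * a * b ^ 3 * c * d + 90 * a ^ 2 + 69 * a ^ 2 * d + 12 * a ^ 2 * d ^ 2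
        + 104 * a ^ 2 * c + 78 * a ^ 2 * c * d + 13 * a ^ 2 * c * d ^ 2 + 14 * a ^ 2 * c ^ 2
        + 9 * a ^ 2 * c ^ 2 * d + 1 * a ^ 2 * c ^ 2 * d ^ 2 + 42 * a ^ 2 * b + 29 * a ^ 2 * b * d
        + 4 * a ^ 2 * b * d ^ 2 + 46 * a ^ 2 * b * c + 31 * a ^ 2 * b * c * d + 4 * a ^ 2 * b * c * d ^ 2
        + 4 * a ^ 2 * b * c ^ 2 + 2 * a ^ 2 * b * c ^ 2 * d + 4 * a ^ 2 * b ^ 2 + 2 * a ^ 2 * b ^ 2 * d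
        + 4 * a ^ 2 * b ^ 2 * c + 2 * a ^ 2 * b ^ 2 * c * d + 6 * a ^ 3 + 3 * a ^ 3 * d + 6 * a ^ 3 * c
        + 3 * a ^ 3 * c * d + 2 * a ^ 3 * b + 1 * a ^ 3 * b * d + 2 * a ^ 3 * b * c + 1 * a ^ 3 * b * c * d := by
    ring
  rw [key]
  positivity

/-- Certificate I in `ℤ`, in the variables `u, m, J, k` (`3 ≤ k`, `k ≤ u + 1`, `1 ≤ J`, `J + 1 ≤ m`). -/
lemma mu_nonneg_int (u m J k : ℤ) (hk : 3 ≤ k) (hu : k ≤ u + 1) (hJ : 1 ≤ J) (hJm : J + 1 ≤ m) :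
    0 ≤ ((u + m + k + 1) * (m - J) * (u + m) * (k - 1) - ((m - J) * (u + m + J + k) + (u + m + J + 1) * (J + k)) * ((k - 1) * (m - J) - (u + 1) * (J + 1))) := by
  have h := uniform_mu_nonneg ((u : ℚ) - (k - 1)) ((J : ℚ) - 1) ((m : ℚ) - J - 1) ((k : ℚ) - 3)
    (by have : (k : ℚ) ≤ u + 1 := by exact_mod_cast hu
        linarith)
    (by have : (1 : ℚ) ≤ J := by exact_mod_cast hJ
        linarith)
    (by have : (J : ℚ) + 1 ≤ m := by exact_mod_cast hJm
        linarith)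
    (by have : (3 : ℚ) ≤ k := by exact_mod_cast hk
        linarith)
  have e : ((((k : ℚ) - 3 + 2 + ((u : ℚ) - (k - 1))) + (((J : ℚ) - 1) + 2 + ((m : ℚ) - J - 1)) + (((k : ℚ) - 3) + 3) + 1) * ((((J : ℚ) - 1) + 2 + ((m : ℚ) - J - 1)) - (((J : ℚ) - 1) + 1)) * (((k : ℚ) - 3 + 2 + ((u : ℚ) - (k - 1))) + (((J : ℚ) - 1) + 2 + ((m : ℚ) - J - 1))) * ((((k : ℚ) - 3) + 3) - 1) - (((((J : ℚ) - 1) + 2 + ((m : ℚ) - J - 1)) - (((J : ℚ) - 1) + 1)) * (((k : ℚ) - 3 + 2 + ((u : ℚ) - (k - 1))) + (((J : ℚ) - 1) + 2 + ((m : ℚ) - J - 1)) + (((J : ℚ) - 1) + 1) + (((k : ℚ) - 3) + 3)) + (((k : ℚ) - 3 + 2 + ((u : ℚ) - (k - 1))) + (((J : ℚ) - 1) + 2 + ((m : ℚ) - J - 1)) + (((J : ℚ) - 1) + 1) + 1) * ((((J : ℚ) - 1) + 1) + (((k : ℚ) - 3) + 3))) * (((((k : ℚ) - 3) + 3) - 1)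 * ((((J : ℚ) - 1) + 2 + ((m : ℚ) - J - 1)) - (((J : ℚ) - 1) + 1)) - (((k : ℚ) - 3 + 2 + ((u : ℚ) - (k - 1))) + 1) * ((((J : ℚ) - 1) + 1) + 1))) = (((u : ℚ) + (m : ℚ) + (k : ℚ) + 1) * ((m : ℚ) - (J : ℚ)) * ((u : ℚ) + (m : ℚ)) * ((k : ℚ) - 1) - (((m : ℚ) - (J : ℚ)) * ((u : ℚ) + (m : ℚ) + (J : ℚ) + (k : ℚ)) + ((u : ℚ) + (m : ℚ) + (J : ℚ) + 1) * ((J : ℚ) + (k : ℚ))) * (((k : ℚ) - 1) * ((m : ℚ) - (J : ℚ)) - ((u : ℚ) + 1) * ((J : ℚ) + 1))) := by ring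
  rw [e] at h
  exact_mod_cast h

/-- Certificate II in `ℤ`. -/
lemma two_term_int (u m J k : ℤ) (hk : 3 ≤ k) (hu : k ≤ u + 1) (hJ : 1 ≤ J) (hJm : J + 1 ≤ m) :
    ((m - J) * (u + m + J + k) + (u + m + J + 1) * (J + k)) * (u + 1) * (u + 2) * (J + 1) * (J + 2)
      ≤ ((u + m + k + 1) * (m - J) * (u + m) * (k - 1) - ((m - J) * (u + m + J + k) + (u + m + J + 1) * (J + k)) * ((k - 1) * (m - J) - (u + 1) * (J + 1))) * ((u + 2) * (J + 2) + (k - 1) * (m - J)) := by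
  have h := uniform_two_term ((u : ℚ) - (k - 1)) ((J : ℚ) - 1) ((m : ℚ) - J - 1) ((k : ℚ) - 3)
    (by have : (k : ℚ) ≤ u + 1 := by exact_mod_cast hu
        linarith)
    (by have : (1 : ℚ) ≤ J := by exact_mod_cast hJ
        linarith)
    (by have : (J : ℚ) + 1 ≤ m := by exact_mod_cast hJm
        linarith)
    (by have : (3 : ℚ) ≤ k := by exact_mod_cast hk
        linarith)
  have e1 : (((((J : ℚ) - 1) + 2 + ((m : ℚ) - J - 1)) - (((J : ℚ) - 1) + 1)) * (((k : ℚ) - 3 + 2 + ((u : ℚ) - (k - 1))) + (((J : ℚ) - 1) + 2 + ((m : ℚ) - J - 1)) + (((J : ℚ) - 1) + 1) + (((k : ℚ) - 3) + 3)) + (((k : ℚ) - 3 + 2 + ((u : ℚ) - (k - 1))) + (((J : ℚ) - 1) + 2 + ((m : ℚ) - J - 1)) + (((J : ℚ) - 1) + 1) + 1) * ((((J : ℚ) - 1) + 1) + (((k : ℚ) - 3) + 3))) * (((k : ℚ) - 3 + 2 + ((u : ℚ) - (k - 1))) + 1) * (((k : ℚ) - 3 + 2 + ((u : ℚ) - (k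 - 1))) + 2) * ((((J : ℚ) - 1) + 1) + 1) * ((((J : ℚ) - 1) + 1) + 2)
      = (((m : ℚ) - (J : ℚ)) * ((u : ℚ) + (m : ℚ) + (J : ℚ) + (k : ℚ)) + ((u : ℚ) + (m : ℚ) + (J : ℚ) + 1) * ((J : ℚ) + (k : ℚ))) * ((u : ℚ) + 1) * ((u : ℚ) + 2) * ((J : ℚ) + 1) * ((J : ℚ) + 2) := by ring
  have e2 : ((((k : ℚ) - 3 + 2 + ((u : ℚ) - (k - 1))) + (((J : ℚ) - 1) + 2 + ((m : ℚ) - J - 1)) + (((k : ℚ) - 3) + 3) + 1) * ((((J : ℚ) - 1) + 2 + ((m : ℚ) - J - 1)) - (((J : ℚ) - 1) + 1)) * (((k : ℚ) - 3 + 2 + ((u : ℚ) - (k - 1))) + (((J : ℚ) - 1) + 2 + ((m : ℚ) - J - 1))) * ((((k : ℚ) - 3) + 3) - 1) - (((((J : ℚ) - 1) + 2 + ((m : ℚ) - J - 1)) - (((J : ℚ) - 1) + 1)) * (((k : ℚ) - 3 + 2 + ((u : ℚ) - (k - 1))) + (((J : ℚ) - 1) + 2 + ((m : ℚ) - J - 1))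 + (((J : ℚ) - 1) + 1) + (((k : ℚ) - 3) + 3)) + (((k : ℚ) - 3 + 2 + ((u : ℚ) - (k - 1))) + (((J : ℚ) - 1) + 2 + ((m : ℚ) - J - 1)) + (((J : ℚ) - 1) + 1) + 1) * ((((J : ℚ) - 1) + 1) + (((k : ℚ) - 3) + 3))) * (((((k : ℚ) - 3) + 3) - 1) * ((((J : ℚ) - 1) + 2 + ((m : ℚ) - J - 1)) - (((J : ℚ) - 1) + 1)) - (((k : ℚ) - 3 + 2 + ((u : ℚ) - (k - 1))) + 1) * ((((J : ℚ) - 1) + 1) + 1))) * ((((k : ℚ) - 3 + 2 + ((u : ℚ) - (k - 1))) + 2) * ((((J : ℚ) - 1) + 1) + 2) + ((((k : ℚ) - 3) + 3) - 1) * ((((J : ℚ) - 1) + 2 + ((m : ℚ) - J - 1)) - (((J : ℚ) - 1) + 1)))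
      = (((u : ℚ) + (m : ℚ) + (k : ℚ) + 1) * ((m : ℚ) - (J : ℚ)) * ((u : ℚ) + (m : ℚ)) * ((k : ℚ) - 1) - (((m : ℚ) - (J : ℚ)) * ((u : ℚ) + (m : ℚ) + (J : ℚ) + (k : ℚ)) + ((u : ℚ) + (m : ℚ) + (J : ℚ) + 1) * ((J : ℚ) + (k : ℚ))) * (((k : ℚ) - 1) * ((m : ℚ) - (J : ℚ)) - ((u : ℚ) + 1) * ((J : ℚ) + 1))) * (((u : ℚ) + 2) * ((J : ℚ) + 2) + ((k : ℚ) - 1) * ((m : ℚ) - (J : ℚ))) := by ring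
  rw [e1, e2] at h
  exact_mod_cast h

/-! ### The per-term identity (steps (1) and (3)) -/

/-- **The row step, term by term**: for `0 < i < k`, with `B = C(n, i)`, `A = C(m+1, J+k−i)` (`n = u + k`, `q = u + m`),
`(q+k+1)(m+1)·[B·C(m, J+k−i)(q+J+1)(J+k) − B·C(m, J+k−1−i)(m−J)(q+J+k)] = Γ·n(m+1)·(Z(i−1) − Z(i)) + μ·B·A`. -/
lemma rowstep_term (u m J k i : ℕ) (hi : 0 < i) (hik : i < k) :
    ((u : ℤ) + m + k + 1) * ((m : ℤ) + 1)
        * (((u + k).choose i : ℤ) * (m.choose (J + 1 + (k - 1) - i) : ℤ) * ((u : ℤ) + m + J + 1) * ((J : ℤ) + k)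
          - ((u + k).choose i : ℤ) * (m.choose (J + (k - 1) - i) : ℤ) * ((m : ℤ) - J) * ((u : ℤ) + m + J + k))
      = (((m : ℤ) - (J : ℤ)) * ((u : ℤ) + (m : ℤ) + (J : ℤ) + (k : ℤ)) + ((u : ℤ) + (m : ℤ) + (J : ℤ) + 1) * ((J : ℤ) + (k : ℤ))) * ((u : ℤ) + k) * ((m : ℤ) + 1)
          * (((u + k - 1).choose (i - 1) : ℤ) * (m.choose (J + 1 + (k - 1) - i) : ℤ)
            - ((u + k - 1).choose i : ℤ) * (m.choose (J + (k - 1) - i) : ℤ))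
        + (((u : ℤ) + (m : ℤ) + (k : ℤ) + 1) * ((m : ℤ) - (J : ℤ)) * ((u : ℤ) + (m : ℤ)) * ((k : ℤ) - 1) - (((m : ℤ) - (J : ℤ)) * ((u : ℤ) + (m : ℤ) + (J : ℤ) + (k : ℤ)) + ((u : ℤ) + (m : ℤ) + (J : ℤ) + 1) * ((J : ℤ) + (k : ℤ))) * (((k : ℤ) - 1) * ((m : ℤ) - (J : ℤ)) - ((u : ℤ) + 1) * ((J : ℤ) + 1))) * (((u + k).choose i : ℤ) * ((m + 1).choose (J + 1 + (k - 1) - i) : ℤ)) := by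
  obtain ⟨i', rfl⟩ : ∃ i', i = i' + 1 := ⟨i - 1, by omega⟩
  obtain ⟨s, rfl⟩ : ∃ s, k = i' + s + 2 := ⟨k - i' - 2, by omega⟩
  rw [show J + 1 + (i' + s + 2 - 1) - (i' + 1) = J + s + 1 by omega,
    show J + (i' + s + 2 - 1) - (i' + 1) = J + s by omega,
    show u + (i' + s + 2) - 1 = u + i' + s + 1 by omega, show i' + 1 - 1 = i' by omega]
  -- the four binomial ratios
  have e1 : ((m : ℤ) + 1) * (m.choose (J + s + 1) : ℤ) = ((m + 1).choose (J + s + 1) : ℤ) * ((m : ℤ) - J - s) := by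
    rcases Nat.lt_or_ge m (J + s) with h | h
    · rw [Nat.choose_eq_zero_of_lt (by omega : m < J + s + 1),
        Nat.choose_eq_zero_of_lt (by omega : m + 1 < J + s + 1)]
      simp
    · have := Nat.choose_mul_succ_eq m (J + s + 1)
      rw [show m + 1 - (J + s + 1) = m - (J + s) by omega] at this
      have hc : ((m - (J + s) : ℕ) : ℤ) = (m : ℤ) - J - s := by omega
      have h' : ((m.choose (J + s + 1) * (m + 1) : ℕ) : ℤ) = (((m + 1).choose (J + s + 1) * (m - (J + s)) : ℕ) : ℤ) := by
        exact_mod_cast this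
      push_cast [hc] at h'
      linear_combination h'
  have e2 : ((m : ℤ) + 1) * (m.choose (J + s) : ℤ) = ((m + 1).choose (J + s + 1) : ℤ) * ((J : ℤ) + s + 1) := by
    have := Nat.add_one_mul_choose_eq m (J + s)
    exact_mod_cast this
  have e3 : ((u : ℤ) + (i' + s + 2)) * ((u + i' + s + 1).choose i' : ℤ)
      = ((u + (i' + s + 2)).choose (i' + 1) : ℤ) * ((i' : ℤ) + 1) := by
    have := Nat.add_one_mul_choose_eq (u + i' + s + 1) i'
    rw [show u + i' + s + 1 + 1 = u + (i' + s + 2) by omega] at this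
    exact_mod_cast this
  have e4 : ((u : ℤ) + (i' + s + 2)) * ((u + i' + s + 1).choose (i' + 1) : ℤ)
      = ((u + (i' + s + 2)).choose (i' + 1) : ℤ) * ((u : ℤ) + s + 1) := by
    have := Nat.choose_mul_succ_eq (u + i' + s + 1) (i' + 1)
    rw [show u + i' + s + 1 + 1 = u + (i' + s + 2) by omega,
      show u + (i' + s + 2) - (i' + 1) = u + s + 1 by omega] at this
    have h' : (((u + i' + s + 1).choose (i' + 1) * (u + (i' + s + 2)) : ℕ) : ℤ)
        = (((u + (i' + s + 2)).choose (i' + 1) * (u + s + 1) : ℕ) : ℤ) := by exact_mod_cast this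
    push_cast at h'
    linear_combination h'
  push_cast
  linear_combination
    ((((u : ℤ) + m) + ((i' : ℤ) + s + 2) + 1) * ((u + (i' + s + 2)).choose (i' + 1) : ℤ) * ((u : ℤ) + m + J + 1) * ((J : ℤ) + ((i' : ℤ) + s + 2))
        - (((m : ℤ) - (J : ℤ)) * ((u : ℤ) + (m : ℤ) + (J : ℤ) + ((i' : ℤ) + s + 2)) + ((u : ℤ) + (m : ℤ) + (J : ℤ) + 1) * ((J : ℤ) + ((i' : ℤ) + s + 2))) * ((u + (i' + s + 2)).choose (i' + 1) : ℤ) * ((i' : ℤ) + 1)) * e1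
    - ((((u : ℤ) + m) + ((i' : ℤ) + s + 2) + 1) * ((u + (i' + s + 2)).choose (i' + 1) : ℤ) * ((m : ℤ) - J) * ((u : ℤ) + m + J + ((i' : ℤ) + s + 2))
        - (((m : ℤ) - (J : ℤ)) * ((u : ℤ) + (m : ℤ) + (J : ℤ) + ((i' : ℤ) + s + 2)) + ((u : ℤ) + (m : ℤ) + (J : ℤ) + 1) * ((J : ℤ) + ((i' : ℤ) + s + 2))) * ((u + (i' + s + 2)).choose (i' + 1) : ℤ) * ((u : ℤ) + s + 1)) * e2
    - (((m : ℤ) - (J : ℤ)) * ((u : ℤ) + (m : ℤ) + (J : ℤ) + ((i' : ℤ) + s + 2)) + ((u : ℤ) + (m : ℤ) + (J : ℤ) + 1) * ((J : ℤ) + ((i' : ℤ) + s + 2))) * ((m : ℤ) + 1) * (m.choose (J + s + 1) : ℤ) * e3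
    + (((m : ℤ) - (J : ℤ)) * ((u : ℤ) + (m : ℤ) + (J : ℤ) + ((i' : ℤ) + s + 2)) + ((u : ℤ) + (m : ℤ) + (J : ℤ) + 1) * ((J : ℤ) + ((i' : ℤ) + s + 2))) * ((m : ℤ) + 1) * (m.choose (J + s) : ℤ) * e4

/-! ### The telescoping sum (step (2)) -/

/-- `Σ_{0<i<k} (Z(i−1) − Z(i)) = Z(0) − Z(k−1)`, `Z(i) = C(n−1, i)·C(m, J+k−1−i)`. -/
lemma telescope_Z (u m J k : ℕ) (hk : 1 ≤ k) :
    ∑ i ∈ Ioo 0 k, (((u + k - 1).choose (i - 1) : ℤ) * (m.choose (J + 1 + (k - 1) - i) : ℤ)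
        - ((u + k - 1).choose i : ℤ) * (m.choose (J + (k - 1) - i) : ℤ))
      = (m.choose (J + (k - 1)) : ℤ) - ((u + k - 1).choose (k - 1) : ℤ) * (m.choose J : ℤ) := by
  set f : ℕ → ℤ := fun i => ((u + k - 1).choose i : ℤ) * (m.choose (J + (k - 1) - i) : ℤ) with hf
  have hterm : ∀ i ∈ Ioo 0 k,
      (((u + k - 1).choose (i - 1) : ℤ) * (m.choose (J + 1 + (k - 1) - i) : ℤ)
        - ((u + k - 1).choose i : ℤ) * (m.choose (J + (k - 1) - i) : ℤ)) = f (i - 1) - f i := by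
    intro i hi
    rw [Finset.mem_Ioo] at hi
    simp only [hf]
    rw [show J + (k - 1) - (i - 1) = J + 1 + (k - 1) - i by omega]
  rw [Finset.sum_congr rfl hterm, ← Finset.Ico_succ_left_eq_Ioo, Order.succ_eq_add_one,
    Finset.sum_Ico_eq_sum_range]
  simp only [zero_add, show ∀ j : ℕ, 1 + j = j + 1 from fun j => by omega, Nat.add_sub_cancel]
  rw [Finset.sum_range_sub' f (k - 1)]
  simp only [hf, Nat.choose_zero_right, Nat.cast_one, one_mul, Nat.sub_zero, Nat.add_sub_cancel]

/-! ### The sum identity -/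

/-- **The key identity** (`S₀ = P(J)`, `S₁ = P(J+1)`, `A = Σ a_i`):
`(q+k+1)(m+1)·[S₁(q+J+1)(J+k) − S₀(m−J)(q+J+k)] = Γ·n(m+1)·[C(m, J+k−1) − C(n−1, k−1)C(m, J)] + μ·A`. -/
lemma rowstep_key (u m J k : ℕ) (hk : 1 ≤ k) :
    ((u : ℤ) + m + k + 1) * ((m : ℤ) + 1)
        * (((∑ i ∈ Ioo 0 k, (u + k).choose i * m.choose (J + 1 + (k - 1) - i) : ℕ) : ℤ) * ((u : ℤ) + m + J + 1) * ((J : ℤ) + k)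
          - ((∑ i ∈ Ioo 0 k, (u + k).choose i * m.choose (J + (k - 1) - i) : ℕ) : ℤ) * ((m : ℤ) - J) * ((u : ℤ) + m + J + k))
      = (((m : ℤ) - (J : ℤ)) * ((u : ℤ) + (m : ℤ) + (J : ℤ) + (k : ℤ)) + ((u : ℤ) + (m : ℤ) + (J : ℤ) + 1) * ((J : ℤ) + (k : ℤ))) * ((u : ℤ) + k) * ((m : ℤ) + 1)
          * ((m.choose (J + (k - 1)) : ℤ) - ((u + k - 1).choose (k - 1) : ℤ) * (m.choose J : ℤ))
        + (((u : ℤ) + (m : ℤ) + (k : ℤ) + 1) * ((m : ℤ) - (J : ℤ)) * ((u : ℤ) + (m : ℤ)) * ((k : ℤ) - 1) - (((m : ℤ) - (J : ℤ)) * ((u : ℤ) + (m : ℤ) + (J : ℤ) + (k : ℤ)) + ((u : ℤ) + (m : ℤ) + (J : ℤ) + 1) * ((J : ℤ) + (k : ℤ))) * (((k : ℤ) - 1) * ((m : ℤ) - (J : ℤ)) - ((u : ℤ) + 1) * ((J : ℤ) + 1))) * ((∑ i ∈ Ioo 0 k, (u + k).choose i * (m + 1).choose (J + 1 + (k - 1)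 - i) : ℕ) : ℤ) := by
  rw [← telescope_Z u m J k hk]
  push_cast
  rw [Finset.sum_mul, Finset.sum_mul, Finset.sum_mul, Finset.sum_mul, ← Finset.sum_sub_distrib,
    Finset.mul_sum, Finset.mul_sum, Finset.mul_sum, ← Finset.sum_add_distrib]
  refine Finset.sum_congr rfl (fun i hi => ?_)
  rw [Finset.mem_Ioo] at hi
  have h := rowstep_term u m J k i hi.1 hi.2
  linear_combination h

/-! ### The row step -/

set_option maxHeartbeats 1600000 in
/-- **THE ROW STEP OF THE WHOLE-DIAGONAL PAIRING, UNIFORMLY IN `k`**: for `k ≥ 3`, `u ≥ k − 1`, `1 ≤ J ≤ m − 1`,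
`P(J)·(m−J)·(q+J+k) ≤ P(J+1)·(q+J+1)·(J+k)` (`n = u + k`, `q = u + m`). -/
theorem rowstep_full (u m J k : ℕ) (hk : 3 ≤ k) (hu : k ≤ u + 1) (hJ : 1 ≤ J) (hJm : J + 1 ≤ m) :
    (∑ i ∈ Ioo 0 k, (u + k).choose i * m.choose (J + (k - 1) - i)) * (m - J) * (u + m + J + k)
      ≤ (∑ i ∈ Ioo 0 k, (u + k).choose i * m.choose (J + 1 + (k - 1) - i)) * (u + m + J + 1) * (J + k) := by
  have key := rowstep_key u m J k (by omega)
  have hmu := mu_nonneg_int (u : ℤ) m J k (by exact_mod_cast hk) (by exact_mod_cast hu) (by exact_mod_cast hJ)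
    (by exact_mod_cast hJm)
  have hII := two_term_int (u : ℤ) m J k (by exact_mod_cast hk) (by exact_mod_cast hu) (by exact_mod_cast hJ)
    (by exact_mod_cast hJm)
  set G : ℤ := (((m : ℤ) - (J : ℤ)) * ((u : ℤ) + (m : ℤ) + (J : ℤ) + (k : ℤ)) + ((u : ℤ) + (m : ℤ) + (J : ℤ) + 1) * ((J : ℤ) + (k : ℤ))) with hG
  set MU : ℤ := (((u : ℤ) + (m : ℤ) + (k : ℤ) + 1) * ((m : ℤ) - (J : ℤ)) * ((u : ℤ) + (m : ℤ)) * ((k : ℤ) - 1) - (((m : ℤ) - (J : ℤ)) * ((u : ℤ) + (m : ℤ) + (J : ℤ) + (k : ℤ)) + ((u : ℤ) + (m : ℤ) + (J : ℤ) + 1) * ((J : ℤ) + (k : ℤ))) * (((k : ℤ) - 1) * ((m : ℤ) - (J : ℤ)) - ((u : ℤ) + 1) * ((J : ℤ) + 1))) with hMU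
  -- the two top terms of `A`
  have hA : (u + k).choose (k - 1) * (m + 1).choose (J + 1) + (u + k).choose (k - 2) * (m + 1).choose (J + 2)
      ≤ ∑ i ∈ Ioo 0 k, (u + k).choose i * (m + 1).choose (J + 1 + (k - 1) - i) := by
    have hsub : ({k - 1, k - 2} : Finset ℕ) ⊆ Ioo 0 k := by
      intro i hi
      simp only [Finset.mem_insert, Finset.mem_singleton] at hi
      rw [Finset.mem_Ioo]; omega
    refine le_trans (le_of_eq ?_) (Finset.sum_le_sum_of_subset_of_nonneg hsub (fun i _ _ => by positivity))
    rw [Finset.sum_pair (by omega), show J + 1 + (k - 1) - (k - 1) = J + 1 by omega,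
      show J + 1 + (k - 1) - (k - 2) = J + 2 by omega]
  -- the final inequality: `Γ·n(m+1)·C(n−1,k−1)·C(m,J) ≤ μ·(a_{k−1} + a_{k−2})`
  have hfin : G * ((u : ℤ) + k) * ((m : ℤ) + 1) * (((u + k - 1).choose (k - 1) : ℤ) * (m.choose J : ℤ))
      ≤ MU * (((u + k).choose (k - 1) : ℤ) * ((m + 1).choose (J + 1) : ℤ)
          + ((u + k).choose (k - 2) : ℤ) * ((m + 1).choose (J + 2) : ℤ)) := by
    have g1 : ((u : ℤ) + k) * ((u + k - 1).choose (k - 1) : ℤ) = ((u + k).choose (k - 1) : ℤ) * ((u : ℤ) + 1) := by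
      have := Nat.choose_mul_succ_eq (u + k - 1) (k - 1)
      rw [show u + k - 1 + 1 = u + k by omega, show u + k - (k - 1) = u + 1 by omega] at this
      have h' : (((u + k - 1).choose (k - 1) * (u + k) : ℕ) : ℤ) = (((u + k).choose (k - 1) * (u + 1) : ℕ) : ℤ) := by
        exact_mod_cast this
      push_cast at h'
      linear_combination h'
    have g2 : ((m + 1).choose (J + 1) : ℤ) * ((J : ℤ) + 1) = ((m : ℤ) + 1) * (m.choose J : ℤ) := by
      have := Nat.add_one_mul_choose_eq m J
      have h' : (((m + 1) * m.choose J : ℕ) : ℤ) = (((m + 1).choose (J + 1) * (J + 1) : ℕ) : ℤ) := by exact_mod_cast this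
      push_cast at h'
      linear_combination -h'
    have g3 : ((u + k).choose (k - 2) : ℤ) * ((u : ℤ) + 2) = ((u + k).choose (k - 1) : ℤ) * ((k : ℤ) - 1) := by
      have := Nat.choose_succ_right_eq (u + k) (k - 2)
      rw [show k - 2 + 1 = k - 1 by omega, show u + k - (k - 2) = u + 2 by omega] at this
      have h' : (((u + k).choose (k - 1) * (k - 1) : ℕ) : ℤ) = (((u + k).choose (k - 2) * (u + 2) : ℕ) : ℤ) := by
        exact_mod_cast this
      have hc : ((k - 1 : ℕ) : ℤ) = (k : ℤ) - 1 := by omega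
      push_cast [hc] at h'
      linear_combination -h'
    have g4 : ((m + 1).choose (J + 2) : ℤ) * ((J : ℤ) + 2) = ((m + 1).choose (J + 1) : ℤ) * ((m : ℤ) - J) := by
      have := Nat.choose_succ_right_eq (m + 1) (J + 1)
      rw [show m + 1 - (J + 1) = m - J by omega] at this
      have h' : (((m + 1).choose (J + 1 + 1) * (J + 1 + 1) : ℕ) : ℤ) = (((m + 1).choose (J + 1) * (m - J) : ℕ) : ℤ) := by
        exact_mod_cast this
      have hc : ((m - J : ℕ) : ℤ) = (m : ℤ) - J := by omega
      push_cast [hc] at h'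
      linear_combination h'
    have hpos : (0 : ℤ) < ((u : ℤ) + 2) * ((J : ℤ) + 1) * ((J : ℤ) + 2) := by positivity
    refine le_of_mul_le_mul_right ?_ hpos
    have hX : (0 : ℤ) ≤ ((u + k).choose (k - 1) : ℤ) * ((m : ℤ) + 1) * (m.choose J : ℤ) := by positivity
    have hid : MU * (((u + k).choose (k - 1) : ℤ) * ((m + 1).choose (J + 1) : ℤ)
          + ((u + k).choose (k - 2) : ℤ) * ((m + 1).choose (J + 2) : ℤ)) * (((u : ℤ) + 2) * ((J : ℤ) + 1) * ((J : ℤ) + 2))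
        - G * ((u : ℤ) + k) * ((m : ℤ) + 1) * (((u + k - 1).choose (k - 1) : ℤ) * (m.choose J : ℤ))
          * (((u : ℤ) + 2) * ((J : ℤ) + 1) * ((J : ℤ) + 2))
        = (((u + k).choose (k - 1) : ℤ) * ((m : ℤ) + 1) * (m.choose J : ℤ))
          * (MU * (((u : ℤ) + 2) * ((J : ℤ) + 2) + ((k : ℤ) - 1) * ((m : ℤ) - (J : ℤ)))
            - G * ((u : ℤ) + 1) * ((u : ℤ) + 2) * ((J : ℤ) + 1) * ((J : ℤ) + 2)) := by
      linear_combination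
        (MU * ((u + k).choose (k - 1) : ℤ) * ((u : ℤ) + 2) * ((J : ℤ) + 2)
          + MU * ((u + k).choose (k - 1) : ℤ) * ((k : ℤ) - 1) * ((m : ℤ) - J)) * g2
        + (MU * ((J : ℤ) + 1) * ((m + 1).choose (J + 1) : ℤ) * ((m : ℤ) - J)) * g3
        + (MU * ((J : ℤ) + 1) * ((u + k).choose (k - 2) : ℤ) * ((u : ℤ) + 2)) * g4
        - (G * ((m : ℤ) + 1) * (m.choose J : ℤ) * (((u : ℤ) + 2) * ((J : ℤ) + 1) * ((J : ℤ) + 2))) * g1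
    have hnn := mul_nonneg hX (sub_nonneg.2 hII)
    linarith [hid, hnn]
  -- assemble in `ℤ`
  have hA' : (((u + k).choose (k - 1) * (m + 1).choose (J + 1) + (u + k).choose (k - 2) * (m + 1).choose (J + 2) : ℕ) : ℤ)
      ≤ ((∑ i ∈ Ioo 0 k, (u + k).choose i * (m + 1).choose (J + 1 + (k - 1) - i) : ℕ) : ℤ) := by exact_mod_cast hA
  have hD : (0 : ℤ) ≤ ((u : ℤ) + m + k + 1) * ((m : ℤ) + 1)
      * (((∑ i ∈ Ioo 0 k, (u + k).choose i * m.choose (J + 1 + (k - 1) - i) : ℕ) : ℤ) * ((u : ℤ) + m + J + 1) * ((J : ℤ) + k)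
        - ((∑ i ∈ Ioo 0 k, (u + k).choose i * m.choose (J + (k - 1) - i) : ℕ) : ℤ) * ((m : ℤ) - J) * ((u : ℤ) + m + J + k)) := by
    rw [key]
    have hGnn : (0 : ℤ) ≤ G := by
      rw [hG]
      have : (J : ℤ) + 1 ≤ m := by exact_mod_cast hJm
      nlinarith
    have h1 : (0 : ℤ) ≤ G * ((u : ℤ) + k) * ((m : ℤ) + 1) * (m.choose (J + (k - 1)) : ℤ) := by positivity
    have h2 := mul_le_mul_of_nonneg_left hA' hmu
    push_cast at h2 ⊢
    linarith [h1, h2, hfin]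
  have hpos : (0 : ℤ) < ((u : ℤ) + m + k + 1) * ((m : ℤ) + 1) := by positivity
  have hD' := nonneg_of_mul_nonneg_right hD hpos
  have hmJ : ((m - J : ℕ) : ℤ) = (m : ℤ) - J := by omega
  have hfinal : (((∑ i ∈ Ioo 0 k, (u + k).choose i * m.choose (J + (k - 1) - i)) * (m - J) * (u + m + J + k) : ℕ) : ℤ)
      ≤ (((∑ i ∈ Ioo 0 k, (u + k).choose i * m.choose (J + 1 + (k - 1) - i)) * (u + m + J + 1) * (J + k) : ℕ) : ℤ) := by
    push_cast [hmJ] at hD' ⊢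
    linarith
  exact_mod_cast hfinal

end PercRepro
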